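import Summits.BirchSwinnertonDyer.BirchSwinnertonDyer.Theorems.Rank1ResidualJetCarrierNe
import Summits.BirchSwinnertonDyer.BirchSwinnertonDyer.Theorems.Rank1ResidualJetShaVanishingOfGlobalDivisibility
import Summits.BirchSwinnertonDyer.BirchSwinnertonDyer.Theorems.Rank1ResidualJetCarrierEndFormsSwapFinal
import Summits.BirchSwinnertonDyer.Rank1Residual.JET.McCallumProp44ByName
import Literature.NumberTheory.GaloisCohomology.PoitouTateSumTotallyComplex
import Literature.NumberTheory.EllipticCurves.HeegnerPointsImaginaryQuadraticProofs
import Literature.NumberTheory.EllipticCurves.HeegnerPointsOfConductorOneGaloisConjProofs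
import Literature.NumberTheory.EllipticCurves.HeegnerPointsOfConductorOneRationalityProofs
import Literature.NumberTheory.EllipticCurves.CuspFormLFunctionLevelConductorProofs
import HarnessLib

/-!
# T1 JET (cell `bsd-jet`), bucket A (`q ≠ p`): the JET class-free consumer IN THE KERNEL on the
# INDEX-FINITENESS line — `BSD(E,p)` ⟸ {Poitou–Tate for Selmer structures, F1, Gross 3.7 (2), GZK}
# and the row's certificate; NO reading binder, NO McCallum 5.2 / Cor. 5.6, NO Kolyvagin theorem

HONEST FRAMING (programme file `BSD-LIT2PART-PROGRAMME-v1.md` §HONESTY, verbatim): «no tranche here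
proves BSD; ARM L moves the LITERAL column of an r ≤ 1 census into the kernel-proved-modulo-named-print
column; ARM P changes what «named print» is worth.» THEOREMS ONLY (seat `bsd-jet-pv-2`, session g7;
`--supports stmt-BirchSwinnertonDyer-14418`, helper); nothing is booked, 0 classes move (road K is
DOCUMENTARY; bookings are referee A's). Nothing about any particular curve is asserted.

WHAT. The bucket-A class-free consumer `JET.bsdp_of_carrierNeCertificate` (pv-1, `Rank1ResidualJetCarrierNe`)
displays, besides the per-row certificate, SIX class-free binders: the READING `hJ` (K1), McCallum 1991
Cor. 5.6 `hMcU`, Kolyvagin's theorem `hKo` (rank one AND `Ш(E/K)` finite), Shimura reciprocity `hrec`,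
Darmon 3.6 `hD36`, GZK `hGZK`. After road K (pv-2 g6: `hJ` ⟸ {PT, F1, Gross 3.7 (2)}, McCallum 5.2
struck) and pv-1 g9's Ш-half (`hMcU` at `t = M₀` ⟸ {PT-sum, [McC] 4.4, F1}) two of them are kernel
theorems modulo named print. THIS FILE removes a THIRD, Kolyvagin's theorem, on the line where the row's
index datum is read as what the register computes — a FINITE index `[E(K) : ℤP] ≠ 0` (equivalently:
`ℤP` has finite index, i.e. `rank E(K) = 1`, which any computation of `ord_p [E(K):ℤP]` presupposes):
* §1 `sha_primary_eq_bot_of_carrierNe_of_index_ne_zero` — `Ш(E/K)[p^∞] = ⊥` from `hJ`, [McC] 4.4, F1,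
  the frame binders and `[E(K):ℤP] ≠ 0`, `ord_p [E(K):ℤP] ≤ ord_p c_q`: with `M₀ := ord_p [E(K):ℤP]`,
  `p^{M₀+1} ∤ P` in `E(K)` is GROUP THEORY (a root `Q` of `P = p^{M₀+1} Q` has order `p^{M₀+1}` in
  `E(K)/ℤP`, so `p^{M₀+1} ∣ [E(K):ℤP]`), `hJ` at depth `s = M₀ ≤ ord_p c_q` is the global divisibility
  `p^{M₀} ∣ P_n`, and pv-1's `JET.DividedDescent.sha_primary_eq_bot_of_globalDivisibility` concludes — its
  Poitou–Tate input `poitouTate_sum_localTatePairing_eq_zero K` being the tree THEOREM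
  `poitouTate_sum_localTatePairing_eq_zero_of_isTotallyComplex` (Tate, C–F VII §11; cell bsd-cn100) at an
  imaginary quadratic `K`. NO Mordell–Weil rank, NO finiteness of `Ш(E/K)`, NO `Nat.card Ш`.
* §2 `noPTorsion_of_carrierNeCertificate_of_index_ne_zero` — `Ш(E/ℚ)[p] = 0` (restriction injective on
  `p`-torsion, `p` odd).
* §3 `bsdp_of_carrierNeCertificate_of_index_ne_zero` (+ `_of_five_le`, Serre tower) — `BSD(E,p)` at a
  `p`-unit `#Ш_an` in analytic rank `≤ 1` (`Typed.bsdp_of_shaAn_unit_of_noPTorsion`, GZK).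
* §4 `…_of_swapLiterature_of_index_ne_zero` — every class-free binder except GZK FED BY NAME: `hJ :=
  JET.jetchevDivisibilityCarrierNe_of_swapLiterature hPT hF1 h372` (p558893), [McC] 4.4 :=
  `JET.prop44_of_frobeniusCongruence h372` (ty), `hrec`/`hD36` := the Literature theorems
  `heegnerPointOfConductor_one_galoisConj_holds` / `phi_heegnerTau_mem_singularModuliField_holds`.
  DISPLAYED named print: `poitouTate_selmerStructure_duality_conj` (∀ K), `Gross1991_heegnerPoint_sub_ratTorsion_mem_E0`,
  `GrossLMS1991.prop37_2_frobeniusCongruence`, `rank_eq_analyticRank_of_analyticRank_le_one` — and nothing else.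
* Level forms (`N` any Heegner level of the row, Carayol from modularity) are in the sibling
  `Rank1ResidualJetCarrierNeIndexKernelRows.lean`.
RELATION TO THE BOOKED GRAMMAR. The register rows display `hv : ord_p [E(K):ℤP] ≤ w` on an abstract
Heegner point; there `[E(K):ℤP] = 0` (infinite index) is not excluded by the binder and Kolyvagin's
theorem (`hKo`) is what excludes it. Here the exclusion is the displayed datum `hfin`. Which line a desk
cites is the desk's business; both are theorems. References: [cite: Jetchev2008, Thm. 1.4, Cor. 1.5 (p. 812)]
[cite: McCallumLMS1991, §5 Lemma 5.1 (p. 303), Cor. 5.6 (p. 310)] [cite: GrossLMS1991, Thm. 1.3, §10]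
[cite: CasselsFrohlichANT1967, Ch. VII §11] [cite: MilneADT2006, Ch. I, Thm. 4.10(b)]. Design: no
definitions; `K : Type`. Axioms: `propext`, `Classical.choice`, `Quot.sound`.
-/

set_option autoImplicit false

noncomputable section

open scoped Classical

open WeierstrassCurve Literature.NumberTheory.EllipticCurves
  Literature.NumberTheory.EllipticCurves.ModularForms
  Literature.NumberTheory.EllipticCurves.Rank1Residual
  Literature.NumberTheory.GaloisCohomology
  Summit.BirchSwinnertonDyer.Rank1Residual Summit.BirchSwinnertonDyer.Rank1Residual.X11b

namespace Summit.BirchSwinnertonDyer.Rank1Residual.JET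

/-! ### §0 Group theory: the `p`-adic depth of a point of finite index -/

/-- **A point of finite non-zero index is not `p^{M₀+1}`-divisible for `M₀ = ord_p` of its index.**
In an additive commutative group `A`, if `P` has `[A : ℤP] ≠ 0` and `P` is of infinite order, then
`P ≠ p^{M₀+1} • Q` for every `Q`, where `M₀ = ord_p [A : ℤP]`: otherwise the class of `Q` in `A/ℤP`
has order exactly `p^{M₀+1}` (if `p^{M₀} Q = k P = k p^{M₀+1} Q` then `Q`, hence `P`, is torsion), so
`p^{M₀+1} ∣ #(A/ℤP) = [A : ℤP]`. McCallum's Lemma 5.1 `M₀ = ord_p [E(K):ℤy_K]` in the direction the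
descent uses, WITHOUT a rank hypothesis. [cite: McCallumLMS1991, §5 Lemma 5.1 (p. 303)] -/
theorem not_exists_pow_succ_smul_eq_of_index_ne_zero {A : Type*} [AddCommGroup A] (p : ℕ)
    [Fact p.Prime] {P : A} (hnt : ¬ IsOfFinAddOrder P) (hfin : (AddSubgroup.zmultiples P).index ≠ 0) :
    ¬ ∃ Q : A, ((p ^ (padicValNat p (AddSubgroup.zmultiples P).index + 1) : ℕ) : ℤ) • Q = P := by
  have hp : p.Prime := Fact.out
  set M₀ := padicValNat p (AddSubgroup.zmultiples P).index with hM₀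
  rintro ⟨Q, hQ⟩
  set H := AddSubgroup.zmultiples P with hH
  -- `Q` has infinite order
  have hQinf : ¬ IsOfFinAddOrder Q := fun h ↦ hnt (hQ ▸ h.zsmul)
  -- the class of `Q` in `A ⧸ ℤP` has order `p^{M₀+1}`
  have h1 : (p ^ (M₀ + 1)) • (Q : A ⧸ H) = 0 := by
    rw [← QuotientAddGroup.mk_nsmul, ← natCast_zsmul, hQ, QuotientAddGroup.eq_zero_iff]
    exact AddSubgroup.mem_zmultiples P
  have h0 : ¬ (p ^ M₀) • (Q : A ⧸ H) = 0 := by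
    intro h
    rw [← QuotientAddGroup.mk_nsmul, QuotientAddGroup.eq_zero_iff, hH,
      AddSubgroup.mem_zmultiples_iff] at h
    obtain ⟨k, hk⟩ := h
    -- `k • P = p^{M₀} • Q` with `P = p^{M₀+1} • Q`: `(k p^{M₀+1} - p^{M₀}) • Q = 0`
    have hz : (k * (p ^ (M₀ + 1) : ℕ) - (p ^ M₀ : ℕ) : ℤ) • Q = 0 := by
      rw [sub_smul, mul_smul, hQ, hk, natCast_zsmul, sub_self]
    have hcoef : (k * (p ^ (M₀ + 1) : ℕ) - (p ^ M₀ : ℕ) : ℤ) = 0 := by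
      by_contra hne
      exact hQinf (isOfFinAddOrder_iff_zsmul_eq_zero.mpr ⟨_, hne, hz⟩)
    have hdvd : (p : ℤ) ∣ 1 := by
      refine ⟨k, ?_⟩
      have hpow : ((p ^ M₀ : ℕ) : ℤ) ≠ 0 := by exact_mod_cast pow_ne_zero M₀ hp.ne_zero
      have : ((p ^ M₀ : ℕ) : ℤ) * (k * p - 1) = 0 := by
        rw [sub_eq_zero] at hcoef
        push_cast at hcoef ⊢
        linear_combination hcoef
      rcases mul_eq_zero.mp this with h | h
      · exact absurd h hpow
      · linear_combination -h
    exact hp.not_dvd_one (by exact_mod_cast hdvd)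
  have hord : addOrderOf (Q : A ⧸ H) = p ^ (M₀ + 1) := addOrderOf_eq_prime_pow h0 h1
  -- hence `p^{M₀+1} ∣ [A : ℤP]`, contradicting `M₀ = ord_p [A : ℤP]`
  have hdvd : p ^ (M₀ + 1) ∣ H.index := by
    rw [AddSubgroup.index, ← hord]
    exact addOrderOf_dvd_natCard _
  have hle : M₀ + 1 ≤ M₀ := by
    have := (padicValNat_dvd_iff_le hfin).mp hdvd
    rwa [← hM₀] at this
  omega

/-! ### §1 `Ш(E/K)[p^∞] = ⊥` on the index-finiteness line -/

/-- **`Ш(E/K)[p^∞] = ⊥` from the bucket-A certificate with a FINITE index — no Kolyvagin theorem, no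
McCallum Cor. 5.6.** `W/ℚ` globally minimal, `p` odd with the `p`-adic tower onto, `K` imaginary
quadratic Heegner for `N_E` with `d_K ∉ {−3,−4}`, `P ∈ E(K)` a Heegner point of infinite order with
`[E(K):ℤP] ≠ 0` and `ord_p [E(K):ℤP] ≤ ord_p c_q` at ONE carrier `q ∣ N_E`, `q ≠ p`. Class-free inputs:
the road-K end form `hJ` (K1), McCallum Prop. 4.4 `h44`, F1 `hF1` (named print), Shimura reciprocity
`hrec` and Darmon 3.6 `hD36` (Literature theorems, fed in §4). Steps: frame and conductor-`1` datum of
`P`; `M₀ := ord_p [E(K):ℤP]`; `p^{M₀+1} ∤ P` (§0); `hJ` at depth `M₀` = global divisibility; pv-1's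
divided descent `JET.DividedDescent.sha_primary_eq_bot_of_globalDivisibility`, whose Poitou–Tate input is
the tree theorem `poitouTate_sum_localTatePairing_eq_zero_of_isTotallyComplex K`.
[cite: Jetchev2008, Cor. 1.5 (p. 812)] [cite: McCallumLMS1991, §5 Lemma 5.1, Cor. 5.6]
[cite: GrossLMS1991, §10] [cite: CasselsFrohlichANT1967, Ch. VII §11] -/
theorem sha_primary_eq_bot_of_carrierNe_of_index_ne_zero
    (hJ : JetchevDivisibilityCarrierNe)
    (h44 : McCallum1991.prop44_localOrder_kolyvaginClass_mul_eq)
    (hF1 : Gross1991_heegnerPoint_sub_ratTorsion_mem_E0)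
    (W : WeierstrassCurve ℚ) [W.IsElliptic] [W.IsGloballyMinimal] [NeZero (W.conductorNorm ℤ)]
    (K : Type) [Field K] [NumberField K]
    (hrec : heegnerPointOfConductor_one_galoisConj (W.conductorNorm ℤ) W K)
    (hD36 : phi_heegnerTau_mem_singularModuliField (W.conductorNorm ℤ) W K)
    (hK : IsImaginaryQuadratic K)
    (hD3 : NumberField.discr K ≠ -3) (hD4 : NumberField.discr K ≠ -4)
    (hH : SatisfiesHeegnerHypothesis (W.conductorNorm ℤ) K)
    (p : ℕ) [Fact p.Prime] (hp2 : p ≠ 2)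
    (htower : ∀ n : ℕ, W.HasSurjectiveModNGaloisRep (p ^ n : ℕ))
    {P : (W.baseChange K).toAffine.Point} (hP : IsHeegnerPoint (W.conductorNorm ℤ) W K P)
    (hnt : ¬ IsOfFinAddOrder P)
    (q : ℕ) [Fact q.Prime] (hq : q ∣ W.conductorNorm ℤ) (hqp : q ≠ p)
    (hfin : (AddSubgroup.zmultiples P).index ≠ 0)
    (hI : padicValNat p (AddSubgroup.zmultiples P).index ≤
      padicValNat p ((W.baseChange ℚ_[q]).localTamagawaNumber ℤ_[q])) :
    AddCommGroup.primaryComponent (W.baseChange K).sha p = ⊥ := by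
  -- no CM: `ρ̄_{E,p}` onto at an odd prime
  have hsurj : W.HasSurjectiveModNGaloisRep (p : ℤ) := by simpa using htower 1
  have hcm : ¬ W.HasCM := fun hCM ↦
    W.not_hasSurjectiveModNGaloisRep_of_hasCM hCM (Fact.out : p.Prime) hp2 (by simpa using hsurj)
  -- a frame of `P` and a conductor-1 datum on it (Darmon 3.6), with bottom point `P` (Shimura)
  obtain ⟨Dt, H, ι, hPc⟩ := id hP
  obtain ⟨d₁⟩ := exists_kolyvaginHeegnerData_one hD36 hK Dt H.β ι H.dvd_sq_sub
  have hPd : d₁.toGeomPoints d₁.derivedPoint = toGeomPoints (W.baseChange K) P :=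
    KolyvaginBottom.toGeomPoints_derivedPoint_one_eq hrec hK hH hPc d₁ rfl
  -- `P_1` has infinite order since `P` has
  have hy₁ : ¬ IsOfFinAddOrder d₁.derivedPoint := by
    intro hfo
    apply hnt
    have h1 : IsOfFinAddOrder (d₁.toGeomPoints d₁.derivedPoint) := d₁.toGeomPoints.isOfFinAddOrder hfo
    rw [hPd] at h1
    exact (toGeomPoints_injective (W.baseChange K)).isOfFinAddOrder_iff.mp h1
  -- the depth `M₀ = ord_p [E(K):ℤP]`: `p^{M₀+1} ∤ P` (§0) and global divisibility to depth `M₀` (K1)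
  set M₀ := padicValNat p (AddSubgroup.zmultiples P).index with hM₀
  have hmax : ¬ ∃ Q : (W.baseChange K).toAffine.Point, ((p ^ (M₀ + 1) : ℕ) : ℤ) • Q = P :=
    not_exists_pow_succ_smul_eq_of_index_ne_zero p hnt hfin
  have hdiv : ∀ (n : ℕ) (d : KolyvaginHeegnerData Dt H.β ι n), Squarefree n →
      (∀ ℓ ∈ n.primeFactors, Zhang2014.IsKolyvaginPrime (W.conductorNorm ℤ) W K p ℓ ∧
        M₀ ≤ Zhang2014.kolyvaginIndex W p ℓ) →
      ∃ Q : (W.baseChange (ringClassField K ι n)).toAffine.Point,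
        ((p ^ M₀ : ℕ) : ℤ) • Q = d.derivedPoint :=
    fun n d hn hℓ ↦ hJ W hcm K hK hD3 hD4 hH p hp2 htower Dt H.β ι d₁ hy₁ q hq hqp M₀ hI n d hn hℓ
  -- Poitou–Tate sum formula at the imaginary quadratic `K`: a tree THEOREM (Tate, C–F VII §11)
  haveI : NumberField.IsTotallyComplex K := hK.isTotallyComplex
  have hPT : poitouTate_sum_localTatePairing_eq_zero K :=
    poitouTate_sum_localTatePairing_eq_zero_of_isTotallyComplex K
  -- pv-1's divided descent (Gross §10 on `P_n ∕ p^{M₀}` at level `p`)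
  exact DividedDescent.sha_primary_eq_bot_of_globalDivisibility W hcm K hK hD3 hD4 hH p hp2 htower Dt H.β
    ι d₁ P hPd hP hnt M₀ hmax hdiv hPT h44 hF1

/-! ### §2 `Ш(E/ℚ)[p] = 0` -/

/-- **The bucket-A certificate with a finite index gives `Ш(E/ℚ)[p] = 0`** — §1 and the injectivity of
restriction `Ш(E/ℚ) → Ш(E/K)` on `Ш(E/ℚ)[p]` (`p` odd, `[K:ℚ] = 2`). Same binders as §1; NO Kolyvagin
theorem, NO McCallum Cor. 5.6, NO finiteness of `Ш`. [cite: Jetchev2008, Cor. 1.5 (p. 812)]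
[cite: GrossLMS1991, §10] [cite: SerreGaloisCohomology1997, I.§2.4 Cor. to Prop. 9] -/
theorem noPTorsion_of_carrierNeCertificate_of_index_ne_zero
    (hJ : JetchevDivisibilityCarrierNe)
    (h44 : McCallum1991.prop44_localOrder_kolyvaginClass_mul_eq)
    (hF1 : Gross1991_heegnerPoint_sub_ratTorsion_mem_E0)
    (W : WeierstrassCurve ℚ) [W.IsElliptic] [W.IsGloballyMinimal] [NeZero (W.conductorNorm ℤ)]
    (K : Type) [Field K] [NumberField K]
    (hrec : heegnerPointOfConductor_one_galoisConj (W.conductorNorm ℤ) W K)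
    (hD36 : phi_heegnerTau_mem_singularModuliField (W.conductorNorm ℤ) W K)
    (hK : IsImaginaryQuadratic K)
    (hD3 : NumberField.discr K ≠ -3) (hD4 : NumberField.discr K ≠ -4)
    (hH : SatisfiesHeegnerHypothesis (W.conductorNorm ℤ) K)
    (p : ℕ) [Fact p.Prime] (hp2 : p ≠ 2)
    (htower : ∀ n : ℕ, W.HasSurjectiveModNGaloisRep (p ^ n : ℕ))
    {P : (W.baseChange K).toAffine.Point} (hP : IsHeegnerPoint (W.conductorNorm ℤ) W K P)
    (hnt : ¬ IsOfFinAddOrder P)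
    (q : ℕ) [Fact q.Prime] (hq : q ∣ W.conductorNorm ℤ) (hqp : q ≠ p)
    (hfin : (AddSubgroup.zmultiples P).index ≠ 0)
    (hI : padicValNat p (AddSubgroup.zmultiples P).index ≤
      padicValNat p ((W.baseChange ℚ_[q]).localTamagawaNumber ℤ_[q])) :
    ∀ x : W.sha, (p : ℤ) • x = 0 → x = 0 := by
  have hpp : p.Prime := Fact.out
  have hbot := sha_primary_eq_bot_of_carrierNe_of_index_ne_zero hJ h44 hF1 W K hrec hD36 hK hD3 hD4 hH p
    hp2 htower hP hnt q hq hqp hfin hI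
  haveI : IsGalois ℚ K := by
    haveI : Algebra.IsQuadraticExtension ℚ K := ⟨hK.1⟩
    infer_instance
  have hcop : p.Coprime (Module.finrank ℚ K) := by
    rw [hK.1]
    exact (Nat.coprime_primes hpp Nat.prime_two).mpr hp2
  intro x hx
  have hxn : p • x = 0 := by rw [← natCast_zsmul]; exact hx
  -- the restriction of `x` is `p`-torsion, hence in `Ш(E/K)[p^∞] = ⊥`
  have hres : shaRestriction W K x = 0 := by
    have hpr : p ^ 1 • shaRestriction W K x = 0 := by rw [pow_one, ← map_nsmul, hxn, map_zero]
    have hmem : shaRestriction W K x ∈ AddCommGroup.primaryComponent (W.baseChange K).sha p :=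
      (AddCommGroup.mem_primaryComponent).mpr ⟨1, hpr⟩
    rw [hbot] at hmem
    exact (AddSubgroup.mem_bot).mp hmem
  have hx_mem : x ∈ (AddSubgroup.torsionBy W.sha p : Set W.sha) :=
    AddSubgroup.torsionBy.nsmul_iff.mpr hxn
  have h0_mem : (0 : W.sha) ∈ (AddSubgroup.torsionBy W.sha p : Set W.sha) :=
    AddSubgroup.torsionBy.nsmul_iff.mpr (smul_zero _)
  exact injOn_shaRestriction_torsionBy W K hcop hx_mem h0_mem (by rw [hres, map_zero])

/-! ### §3 `BSD(E,p)` -/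

/-- **`BSD(E,p)` from the bucket-A certificate on the index-finiteness line.** Analytic rank `≤ 1`,
`#Ш_an = s` a `p`-unit; `Ш(E/ℚ)[p] = 0` by §2; GZK for the rank part
(`Typed.bsdp_of_shaAn_unit_of_noPTorsion`). Class-free binders: `hJ` (K1), `h44`, `hF1`, `hrec`, `hD36`,
`hGZK` — NO `hKo`, NO `hMcU`. [cite: Jetchev2008, Cor. 1.5 (p. 812)] [cite: Miller2011LMS, Def. 1.1] -/
theorem bsdp_of_carrierNeCertificate_of_index_ne_zero
    (hJ : JetchevDivisibilityCarrierNe)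
    (h44 : McCallum1991.prop44_localOrder_kolyvaginClass_mul_eq)
    (hF1 : Gross1991_heegnerPoint_sub_ratTorsion_mem_E0)
    (hGZK : rank_eq_analyticRank_of_analyticRank_le_one)
    (W : WeierstrassCurve ℚ) [W.IsElliptic] [W.IsGloballyMinimal] [NeZero (W.conductorNorm ℤ)]
    (K : Type) [Field K] [NumberField K]
    (hrec : heegnerPointOfConductor_one_galoisConj (W.conductorNorm ℤ) W K)
    (hD36 : phi_heegnerTau_mem_singularModuliField (W.conductorNorm ℤ) W K)
    (hK : IsImaginaryQuadratic K)
    (hD3 : NumberField.discr K ≠ -3) (hD4 : NumberField.discr K ≠ -4)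
    (hH : SatisfiesHeegnerHypothesis (W.conductorNorm ℤ) K)
    (p : ℕ) [Fact p.Prime] (hp2 : p ≠ 2)
    (htower : ∀ n : ℕ, W.HasSurjectiveModNGaloisRep (p ^ n : ℕ))
    {P : (W.baseChange K).toAffine.Point} (hP : IsHeegnerPoint (W.conductorNorm ℤ) W K P)
    (hnt : ¬ IsOfFinAddOrder P)
    (q : ℕ) [Fact q.Prime] (hq : q ∣ W.conductorNorm ℤ) (hqp : q ≠ p)
    (hfin : (AddSubgroup.zmultiples P).index ≠ 0)
    (hI : padicValNat p (AddSubgroup.zmultiples P).index ≤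
      padicValNat p ((W.baseChange ℚ_[q]).localTamagawaNumber ℤ_[q]))
    (hr : W.analyticRank ≤ 1) {s : ℚ} (hs : shaAn W = (s : ℂ)) (hv : padicValRat p s = 0) :
    BSDp W p :=
  Typed.bsdp_of_shaAn_unit_of_noPTorsion W p hGZK hr hs hv
    (noPTorsion_of_carrierNeCertificate_of_index_ne_zero hJ h44 hF1 W K hrec hD36 hK hD3 hD4 hH p hp2
      htower hP hnt q hq hqp hfin hI)

/-- **`BSD(E,p)` on the index-finiteness line, `p ≥ 5`**: the tower from `ρ̄_{E,p}` onto by Serre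
(`serre_hasSurjectiveModNGaloisRep_pow_holds`). [cite: SerreAbelianLadic1968, Ch. IV §3.4 Lemma 3] -/
theorem bsdp_of_carrierNeCertificate_of_index_ne_zero_of_five_le
    (hJ : JetchevDivisibilityCarrierNe)
    (h44 : McCallum1991.prop44_localOrder_kolyvaginClass_mul_eq)
    (hF1 : Gross1991_heegnerPoint_sub_ratTorsion_mem_E0)
    (hGZK : rank_eq_analyticRank_of_analyticRank_le_one)
    (W : WeierstrassCurve ℚ) [W.IsElliptic] [W.IsGloballyMinimal] [NeZero (W.conductorNorm ℤ)]
    (K : Type) [Field K] [NumberField K]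
    (hrec : heegnerPointOfConductor_one_galoisConj (W.conductorNorm ℤ) W K)
    (hD36 : phi_heegnerTau_mem_singularModuliField (W.conductorNorm ℤ) W K)
    (hK : IsImaginaryQuadratic K)
    (hD3 : NumberField.discr K ≠ -3) (hD4 : NumberField.discr K ≠ -4)
    (hH : SatisfiesHeegnerHypothesis (W.conductorNorm ℤ) K)
    (p : ℕ) [Fact p.Prime] (h5 : 5 ≤ p) (hsurj : W.HasSurjectiveModNGaloisRep p)
    {P : (W.baseChange K).toAffine.Point} (hP : IsHeegnerPoint (W.conductorNorm ℤ) W K P)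
    (hnt : ¬ IsOfFinAddOrder P)
    (q : ℕ) [Fact q.Prime] (hq : q ∣ W.conductorNorm ℤ) (hqp : q ≠ p)
    (hfin : (AddSubgroup.zmultiples P).index ≠ 0)
    (hI : padicValNat p (AddSubgroup.zmultiples P).index ≤
      padicValNat p ((W.baseChange ℚ_[q]).localTamagawaNumber ℤ_[q]))
    (hr : W.analyticRank ≤ 1) {s : ℚ} (hs : shaAn W = (s : ℂ)) (hv : padicValRat p s = 0) :
    BSDp W p := by
  have hp2 : p ≠ 2 := by omega
  exact bsdp_of_carrierNeCertificate_of_index_ne_zero hJ h44 hF1 hGZK W K hrec hD36 hK hD3 hD4 hH p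
    hp2 (serre_hasSurjectiveModNGaloisRep_pow_holds W p h5 hsurj) hP hnt q hq hqp hfin hI hr hs hv

/-! ### §4 Every class-free binder except GZK FED BY NAME: the door ⟸ {PT, F1, Gross 3.7 (2), GZK} -/

/-- **The bucket-A JET door on the index-finiteness line from NAMED PRINT ONLY**: `BSD(E,p)` for
`W/ℚ` globally minimal of analytic rank `≤ 1` with `#Ш_an` a `p`-unit, from the per-row certificate
(`K`, `P`, `q`, `[E(K):ℤP]` finite with `ord_p ≤ ord_p c_q`, the tower at an odd `p`) and FOUR
published statements: Poitou–Tate for Selmer structures (`hPT`, every `K : Type`), F1 = [GZ86 III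
(3.1)] ∕ Gross 1991 §6 (`hF1`), Gross 1991 Prop. 3.7 (2) image-free (`h372`), GZK (`hGZK`). Fed by
name: K1 := `jetchevDivisibilityCarrierNe_of_swapLiterature` (road K, McCallum 5.2 struck), [McC]
4.4 := `prop44_of_frobeniusCongruence`, Shimura reciprocity and Darmon 3.6 := Literature theorems.
NO reading binder, NO McCallum 5.2 / Cor. 5.6, NO Kolyvagin theorem. [cite: Jetchev2008, Thm. 1.4,
Cor. 1.5 (p. 812)] [cite: GrossLMS1991, Prop. 3.7 (2), §10] [cite: GrossZagier1986, III (3.1)]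
[cite: MilneADT2006, Ch. I, Thm. 4.10(b)] -/
theorem bsdp_of_carrierNeCertificate_of_swapLiterature_of_index_ne_zero
    (hPT : ∀ (K : Type) [Field K] [NumberField K], poitouTate_selmerStructure_duality_conj K)
    (hF1 : Gross1991_heegnerPoint_sub_ratTorsion_mem_E0)
    (h372 : GrossLMS1991.prop37_2_frobeniusCongruence)
    (hGZK : rank_eq_analyticRank_of_analyticRank_le_one)
    (W : WeierstrassCurve ℚ) [W.IsElliptic] [W.IsGloballyMinimal] [NeZero (W.conductorNorm ℤ)]
    (K : Type) [Field K] [NumberField K] (hK : IsImaginaryQuadratic K)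
    (hD3 : NumberField.discr K ≠ -3) (hD4 : NumberField.discr K ≠ -4)
    (hH : SatisfiesHeegnerHypothesis (W.conductorNorm ℤ) K)
    (p : ℕ) [Fact p.Prime] (hp2 : p ≠ 2)
    (htower : ∀ n : ℕ, W.HasSurjectiveModNGaloisRep (p ^ n : ℕ))
    {P : (W.baseChange K).toAffine.Point} (hP : IsHeegnerPoint (W.conductorNorm ℤ) W K P)
    (hnt : ¬ IsOfFinAddOrder P)
    (q : ℕ) [Fact q.Prime] (hq : q ∣ W.conductorNorm ℤ) (hqp : q ≠ p)
    (hfin : (AddSubgroup.zmultiples P).index ≠ 0)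
    (hI : padicValNat p (AddSubgroup.zmultiples P).index ≤
      padicValNat p ((W.baseChange ℚ_[q]).localTamagawaNumber ℤ_[q]))
    (hr : W.analyticRank ≤ 1) {s : ℚ} (hs : shaAn W = (s : ℂ)) (hv : padicValRat p s = 0) :
    BSDp W p :=
  bsdp_of_carrierNeCertificate_of_index_ne_zero (jetchevDivisibilityCarrierNe_of_swapLiterature hPT hF1 h372)
    (prop44_of_frobeniusCongruence h372) hF1 hGZK W K
    (heegnerPointOfConductor_one_galoisConj_holds (W.conductorNorm ℤ) W K)
    (phi_heegnerTau_mem_singularModuliField_holds (W.conductorNorm ℤ) W K) hK hD3 hD4 hH p hp2 htower hP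
    hnt q hq hqp hfin hI hr hs hv

/-- **The same, `p ≥ 5`, from `ρ̄_{E,p}` onto** (Serre tower). [cite: SerreAbelianLadic1968, Ch. IV §3.4 Lemma 3] -/
theorem bsdp_of_carrierNeCertificate_of_swapLiterature_of_index_ne_zero_of_five_le
    (hPT : ∀ (K : Type) [Field K] [NumberField K], poitouTate_selmerStructure_duality_conj K)
    (hF1 : Gross1991_heegnerPoint_sub_ratTorsion_mem_E0)
    (h372 : GrossLMS1991.prop37_2_frobeniusCongruence)
    (hGZK : rank_eq_analyticRank_of_analyticRank_le_one)
    (W : WeierstrassCurve ℚ) [W.IsElliptic] [W.IsGloballyMinimal] [NeZero (W.conductorNorm ℤ)]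
    (K : Type) [Field K] [NumberField K] (hK : IsImaginaryQuadratic K)
    (hD3 : NumberField.discr K ≠ -3) (hD4 : NumberField.discr K ≠ -4)
    (hH : SatisfiesHeegnerHypothesis (W.conductorNorm ℤ) K)
    (p : ℕ) [Fact p.Prime] (h5 : 5 ≤ p) (hsurj : W.HasSurjectiveModNGaloisRep p)
    {P : (W.baseChange K).toAffine.Point} (hP : IsHeegnerPoint (W.conductorNorm ℤ) W K P)
    (hnt : ¬ IsOfFinAddOrder P)
    (q : ℕ) [Fact q.Prime] (hq : q ∣ W.conductorNorm ℤ) (hqp : q ≠ p)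
    (hfin : (AddSubgroup.zmultiples P).index ≠ 0)
    (hI : padicValNat p (AddSubgroup.zmultiples P).index ≤
      padicValNat p ((W.baseChange ℚ_[q]).localTamagawaNumber ℤ_[q]))
    (hr : W.analyticRank ≤ 1) {s : ℚ} (hs : shaAn W = (s : ℂ)) (hv : padicValRat p s = 0) :
    BSDp W p := by
  have hp2 : p ≠ 2 := by omega
  exact bsdp_of_carrierNeCertificate_of_swapLiterature_of_index_ne_zero hPT hF1 h372 hGZK W K hK hD3 hD4
    hH p hp2 (serre_hasSurjectiveModNGaloisRep_pow_holds W p h5 hsurj) hP hnt q hq hqp hfin hI hr hs hv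

end Summit.BirchSwinnertonDyer.Rank1Residual.JET

end
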